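import Summits.KontsevichZagierPeriods.KontsevichZagierPeriods.Theorems.LinRedNormalFormHoffmanSpanInKZRefCert

/-!
# Crux `LinRedNormalForm.HoffmanSpanInKZ` (stmt-KontsevichZagierPeriods-15044), line `Sketch`:
# certificate tables with MEMOISED DERIVED RELATIONS (elimination transcripts)

The per-weight EDS certificate tables of this line (`RCert`, `LinRedNormalFormHoffmanSpanInKZRefCert`)
express every admissible word over the Hoffman words by an explicit rational combination of relation
vectors (finite double shuffle, Hoffman's relation, duality) and of words certified earlier.  From weight
`11` on those combinations are long: the first rows of a table are complete proofs, each a combination of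
some `150–250` relation vectors, and every use of a relation vector is re-expanded by the kernel
(`≈ 6·10^5` expansion terms at weight `11`).  This file adds a second kind of table, the transcript of a
sparse Gaussian elimination with MEMOISATION:

* a table of DERIVED ROWS (`DRow`): row `i` names ONE generator `g` of the relation family (`Gen`), cites
  earlier derived rows `k < i` with rational coefficients `L`, and CLAIMS its reduced vector `V`
  explicitly; the kernel checks `g + Σ_k L_k · V_k − V = 0` (radix zero test of
  `LinRedNormalFormHoffmanSpanInKZCertCheck`), reading the earlier claimed vectors `V_k` from memory instead
  of re-deriving them (`dtableOk`, threading the list of vectors verified so far).  Soundness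
  (`clause_of_dtableOk`): every claimed vector realises to an element with an `EdsCertificate` clause
  (indeed a pure relation), by induction, since clauses are closed under `0`, `+`, and rational scaling;
* a table of WORD ROWS (`WRow`): the row of the `i`-th pivot word cites its derived vector `V_i` (one
  citation), the Hoffman words and the words certified before it (`wtableOk`, as `rtableOk`);
  soundness `clause_of_wtableOk`, assembly `edsCertificate_of_dwtables`, splitting lemmas
  `dtableOk_append` / `wtableOk_append` for tables spread over several files.

The kernel cost of a derived row is `|g| + Σ_{k ∈ L} |V_k| + |V|` — the fill-in of the elimination, not
the length of the row as a combination of ORIGINAL generators — which at weight `11` is `≈ 4×` smaller,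
and the file size is governed by `Σ_i |V_i|` (`≈ 7600` entries at weight `11`) instead of
`Σ_i |L⁻¹-row i|` (`≈ 20000` entries with 60-digit rationals).

Sources: K. Ihara, M. Kaneko, D. Zagier, Compos. Math. 142 (2006), §1 (the relation families); the
reflection set-up of `MzvKernelInKZTwoPosetsEdsCertificateLow` and `LinRedNormalFormHoffmanSpanInKZRefCert`
(this tree); for elimination transcripts as certificates cf. folklore ("LU certificate").
-/

namespace Summit.KontsevichZagierPeriods.LinRedNormalForm.HoffmanSpanInKZ

open Literature.NumberTheory.Transcendental
open Summit.KontsevichZagierPeriods.MzvKernelInKZ.Negative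
open Summit.KontsevichZagierPeriods.MzvKernelInKZ.TwoPosets

/-! ## Generators of the relation family -/

/-- One generator of the relation family of `EdsCertificate N`: a finite double shuffle pair `F s t`, a
Hoffman relation index `D s`, or a duality word `K w` (as an index). [folklore] -/
inductive Gen where
  /-- finite double shuffle vector of the pair `(s, t)` -/
  | F (s t : List ℕ)
  /-- Hoffman's relation vector of the index `s` -/
  | D (s : List ℕ)
  /-- duality vector of the word with index `w` -/
  | K (w : List ℕ)

/-- The formal expansion of a generator. [folklore] -/
def Gen.fvec (N : ℕ) : Gen → FVec
  | .F s t => fdsF s t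
  | .D s => hoffmanF s
  | .K w => dualF N (MZV.binaryWord w)

/-- The side conditions of `EdsCertificate` on a generator, as a Boolean. [folklore] -/
def Gen.ok (N : ℕ) : Gen → Bool
  | .F s t => decide (MZV.IsAdmissible s ∧ MZV.IsAdmissible t ∧ s ≠ [] ∧ t ≠ [] ∧
      MZV.weight s + MZV.weight t = N)
  | .D s => decide (MZV.IsAdmissible s ∧ MZV.weight s + 1 = N)
  | .K w => decide (Adm (bword N w))

/-- A generator passing its side conditions realises to a vector with an `EdsCertificate` clause (it is a
single relation vector). [folklore] -/
theorem Gen.clause (N : ℕ) : ∀ g : Gen, g.ok N = true → Clause N (FVec.eval N (g.fvec N))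
  | .F s t, h => by
    simp only [Gen.ok, decide_eq_true_eq] at h
    refine ⟨[], [((s, t), 1)], [], [], by simp, ?_, by simp, by simp, ?_⟩
    · intro p hp
      simp only [List.mem_singleton] at hp
      subst hp
      exact h
    · simp [Gen.fvec, eval_fdsF]
  | .D s, h => by
    simp only [Gen.ok, decide_eq_true_eq] at h
    refine ⟨[], [], [(s, 1)], [], by simp, by simp, ?_, by simp, ?_⟩
    · intro p hp
      simp only [List.mem_singleton] at hp
      subst hp
      exact h
    · simp [Gen.fvec, eval_hoffmanF]
  | .K w, h => by
    simp only [Gen.ok, decide_eq_true_eq] at h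
    refine ⟨[], [], [], [(bword N w, 1)], by simp, by simp, by simp, ?_, ?_⟩
    · intro p hp
      simp only [List.mem_singleton] at hp
      subst hp
      exact h
    · simp [Gen.fvec, eval_dualF, bword]

/-! ## Rational coefficients written as (numerator, denominator) -/

/-- The rational `n / d` encoded by the pair `(n, d)` (so that table literals are `ℤ`/`ℕ` numerals).
[folklore] -/
def qOf (p : ℤ × ℕ) : ℚ := (p.1 : ℚ) / p.2

/-! ## Derived rows: the elimination transcript -/

/-- A derived row: one generator `g`, citations `L` of EARLIER derived rows (index, coefficient), and the
claimed reduced vector `V` (words as indices, coefficients), asserting `V = g + Σ_{(k,c) ∈ L} c · V_k`.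
[folklore] -/
structure DRow where
  /-- the generator entering this row -/
  g : Gen
  /-- earlier derived rows, by index, with coefficients -/
  L : List (ℕ × ℤ × ℕ)
  /-- the claimed vector of this row -/
  V : List (List ℕ × ℤ × ℕ)

/-- The claimed vector of a derived row as a formal combination. [folklore] -/
def DRow.vfvec (d : DRow) : FVec := d.V.map fun p => (MZV.binaryWord p.1, qOf p.2)

/-- The formal expansion of `g + Σ_L c · V_k − V`, the earlier claimed vectors being read from `mem`
(an index out of range reads the empty combination). [folklore] -/
def DRow.fvec (N : ℕ) (mem : List FVec) (d : DRow) : FVec :=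
  d.g.fvec N ++ (d.L.flatMap fun p => FVec.smul (qOf p.2) (mem.getD p.1 [])) ++ FVec.smul (-1) d.vfvec

/-- The derived-row checker: side conditions of the generator and the row identity (radix zero test).
[folklore] -/
def drowOk (N : ℕ) (mem : List FVec) (d : DRow) : Bool :=
  d.g.ok N && zeroTest N (d.fvec N mem)

/-- The derived-table checker: rows in order, threading the list of claimed vectors verified so far.
[folklore] -/
def dtableOk (N : ℕ) : List FVec → List DRow → Bool
  | _, [] => true
  | mem, d :: ds => drowOk N mem d && dtableOk N (mem ++ [d.vfvec]) ds

section Soundness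

variable {N : ℕ}

/-- Reading a vector from a memory of vectors with clauses gives a vector with a clause (out of range: the
empty combination). [folklore] -/
theorem clause_eval_getD (mem : List FVec) (h : ∀ v ∈ mem, Clause N (FVec.eval N v)) (k : ℕ) :
    Clause N (FVec.eval N (mem.getD k [])) := by
  rw [List.getD_eq_getElem?_getD]
  cases hk : mem[k]? with
  | none => simpa using (clause_zero (N := N))
  | some v => exact h v (List.mem_of_getElem? hk)

/-- A rational combination of memory vectors has a clause. [folklore] -/
theorem clause_eval_flatMap_mem (mem : List FVec) (h : ∀ v ∈ mem, Clause N (FVec.eval N v))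
    (L : List (ℕ × ℤ × ℕ)) (f : ℤ × ℕ → ℚ) :
    Clause N (FVec.eval N (L.flatMap fun p => FVec.smul (f p.2) (mem.getD p.1 []))) := by
  induction L with
  | nil => simpa using (clause_zero (N := N))
  | cons a L ih =>
    rw [List.flatMap_cons, FVec.eval_append, FVec.eval_smul]
    exact clause_add (clause_smul _ (clause_eval_getD mem h a.1)) ih

/-- **Soundness of one derived row**: if the memory vectors have clauses and the row checks, its claimed
vector has a clause. [folklore] -/
theorem clause_of_drowOk (mem : List FVec) (hmem : ∀ v ∈ mem, Clause N (FVec.eval N v)) (d : DRow)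
    (h : drowOk N mem d = true) : Clause N (FVec.eval N d.vfvec) := by
  simp only [drowOk, Bool.and_eq_true] at h
  obtain ⟨hg, hz⟩ := h
  have h0 := eval_eq_zero_of_zeroTest N hz
  rw [DRow.fvec, FVec.eval_append, FVec.eval_append, FVec.eval_smul, neg_one_smul,
    ← sub_eq_add_neg, sub_eq_zero] at h0
  rw [← h0]
  exact clause_add (Gen.clause N d.g hg) (clause_eval_flatMap_mem mem hmem d.L qOf)

/-- **Soundness of the derived-table checker**: every claimed vector of a checked table has a clause,
provided the initial memory vectors do. [folklore] -/
theorem clause_of_dtableOk :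
    ∀ (T : List DRow) (mem : List FVec), (∀ v ∈ mem, Clause N (FVec.eval N v)) →
      dtableOk N mem T = true → ∀ v ∈ mem ++ T.map DRow.vfvec, Clause N (FVec.eval N v) := by
  intro T
  induction T with
  | nil => intro mem hmem _ v hv; simpa using hmem v (by simpa using hv)
  | cons d T ih =>
    intro mem hmem h v hv
    simp only [dtableOk, Bool.and_eq_true] at h
    obtain ⟨hd, hT⟩ := h
    have hdv : Clause N (FVec.eval N d.vfvec) := clause_of_drowOk mem hmem d hd
    have hmem' : ∀ v ∈ mem ++ [d.vfvec], Clause N (FVec.eval N v) := by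
      intro v hv
      rcases List.mem_append.1 hv with h' | h'
      · exact hmem v h'
      · simp only [List.mem_singleton] at h'
        subst h'
        exact hdv
    refine ih (mem ++ [d.vfvec]) hmem' hT v ?_
    simpa [List.append_assoc] using hv

/-- Splitting a derived-table check at an append (chunks in several files, each against the memory of
all earlier chunks). [folklore] -/
theorem dtableOk_append (N : ℕ) :
    ∀ (A B : List DRow) (mem : List FVec), dtableOk N mem A = true →
      dtableOk N (mem ++ A.map DRow.vfvec) B = true → dtableOk N mem (A ++ B) = true := by
  intro A
  induction A with
  | nil => intro B mem _ h; simpa using h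
  | cons d A ih =>
    intro B mem h₁ h₂
    simp only [dtableOk, List.cons_append, Bool.and_eq_true] at h₁ ⊢
    refine ⟨h₁.1, ih B (mem ++ [d.vfvec]) h₁.2 ?_⟩
    simpa [List.append_assoc] using h₂

end Soundness

/-! ## Word rows citing derived vectors -/

/-- A word row: the word `w` (as an index), cited earlier-certified words `P`, Hoffman words `H`, and
cited derived vectors `E` (by index), all with coefficients, asserting
`e_w = Σ_P c·e_p + Σ_H c·e_h + Σ_E c·V_k`. [folklore] -/
structure WRow where
  /-- the word, as an index -/
  w : List ℕ
  /-- cited words (as indices), certified earlier in the word table, with coefficients -/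
  P : List (List ℕ × ℤ × ℕ)
  /-- Hoffman indices of weight `N` with coefficients -/
  H : List (List ℕ × ℤ × ℕ)
  /-- cited derived vectors, by index into the derived table, with coefficients -/
  E : List (ℕ × ℤ × ℕ)

/-- The formal expansion of `e_w − Σ_P − Σ_H − Σ_E` of a word row. [folklore] -/
def WRow.fvec (dv : List FVec) (c : WRow) : FVec :=
  (MZV.binaryWord c.w, 1) :: (c.P.map fun p => (MZV.binaryWord p.1, -qOf p.2)) ++
    ((c.H.map fun p => (MZV.binaryWord p.1, -qOf p.2)) ++
      c.E.flatMap fun p => FVec.smul (-qOf p.2) (dv.getD p.1 []))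

/-- The word-row checker: Hoffman side conditions, citations among the words certified before, and the
row identity (radix zero test). [folklore] -/
def wrowOk (N : ℕ) (dv : List FVec) (prev : List (List ℕ)) (c : WRow) : Bool :=
  decide (∀ p ∈ c.H, MZV.IsHoffman p.1 ∧ MZV.weight p.1 = N) &&
  c.P.all (fun p => prev.contains p.1) && zeroTest N (c.fvec dv)

/-- The word-table checker: rows in order, each against the words certified before it. [folklore] -/
def wtableOk (N : ℕ) (dv : List FVec) : List (List ℕ) → List WRow → Bool
  | _, [] => true
  | prev, c :: T => wrowOk N dv prev c && wtableOk N dv (c.w :: prev) T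

section WSoundness

variable {N : ℕ}

/-- Realisation of a list of words with negated coefficients. [folklore] -/
theorem eval_map_neg (N : ℕ) (L : List (List ℕ × ℤ × ℕ)) :
    FVec.eval N (L.map fun p => (MZV.binaryWord p.1, -qOf p.2)) =
      -(L.map fun p => qOf p.2 • unitVec N (bword N p.1)).sum := by
  rw [FVec.eval_map, ← Cert.sum_map_neg]
  congr 1
  exact List.map_congr_left fun p _ => by rw [neg_smul]; rfl

/-- Realisation of the cited derived part with negated coefficients. [folklore] -/
theorem eval_flatMap_neg (N : ℕ) (dv : List FVec) (E : List (ℕ × ℤ × ℕ)) :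
    FVec.eval N (E.flatMap fun p => FVec.smul (-qOf p.2) (dv.getD p.1 [])) =
      -FVec.eval N (E.flatMap fun p => FVec.smul (qOf p.2) (dv.getD p.1 [])) := by
  induction E with
  | nil => simp
  | cons a E ih =>
    simp only [List.flatMap_cons, FVec.eval_append, FVec.eval_smul, ih, neg_smul, neg_add]

/-- A combination of Hoffman words of weight `N` has the obvious clause. [folklore] -/
theorem clause_hoffman (Hq : List (List ℕ × ℚ)) (h : ∀ p ∈ Hq, MZV.IsHoffman p.1 ∧ MZV.weight p.1 = N) :
    Clause N (Hq.map fun p => p.2 • unitVec N (bword N p.1)).sum :=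
  ⟨Hq, [], [], [], h, by simp, by simp, by simp, by simp⟩

/-- **Soundness of one word row**: a checked row whose cited words and derived vectors have clauses
gives the clause of its word. [folklore] -/
theorem clause_of_wrowOk (dv : List FVec) (hdv : ∀ v ∈ dv, Clause N (FVec.eval N v))
    (prev : List (List ℕ)) (hprev : ∀ w ∈ prev, Clause N (unitVec N (bword N w))) (c : WRow)
    (h : wrowOk N dv prev c = true) : Clause N (unitVec N (bword N c.w)) := by
  simp only [wrowOk, Bool.and_eq_true, decide_eq_true_eq, List.all_eq_true] at h
  obtain ⟨⟨hH, hP⟩, hz⟩ := h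
  have h0 := eval_eq_zero_of_zeroTest N hz
  rw [WRow.fvec, FVec.eval_append, FVec.eval_cons, FVec.eval_append, eval_map_neg, eval_map_neg,
    eval_flatMap_neg, one_smul] at h0
  have h1 : unitVec N (bword N c.w) =
      (c.P.map fun p => qOf p.2 • unitVec N (bword N p.1)).sum +
        ((c.H.map fun p => qOf p.2 • unitVec N (bword N p.1)).sum +
          FVec.eval N (c.E.flatMap fun p => FVec.smul (qOf p.2) (dv.getD p.1 []))) := by
    rw [← sub_eq_zero, ← h0]
    simp only [bword]
    abel
  rw [h1]
  refine clause_add ?_ (clause_add ?_ (clause_eval_flatMap_mem dv hdv c.E qOf))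
  · have := clause_sum_refs (N := N) (c.P.map fun p => (p.1, qOf p.2)) fun p hp => by
      obtain ⟨p', hp', rfl⟩ := List.mem_map.1 hp
      exact hprev p'.1 (List.contains_iff_mem.1 (hP p' hp'))
    simpa [List.map_map, Function.comp_def] using this
  · have := clause_hoffman (N := N) (c.H.map fun p => (p.1, qOf p.2)) fun p hp => by
      obtain ⟨p', hp', rfl⟩ := List.mem_map.1 hp
      exact hH p' hp'
    simpa [List.map_map, Function.comp_def] using this

/-- **Soundness of the word-table checker**. [folklore] -/
theorem clause_of_wtableOk (dv : List FVec) (hdv : ∀ v ∈ dv, Clause N (FVec.eval N v)) :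
    ∀ (T : List WRow) (prev : List (List ℕ)), (∀ w ∈ prev, Clause N (unitVec N (bword N w))) →
      wtableOk N dv prev T = true → ∀ c ∈ T, Clause N (unitVec N (bword N c.w)) := by
  intro T
  induction T with
  | nil => intro _ _ _ c hc; simp at hc
  | cons c T ih =>
    intro prev hprev h c' hc'
    simp only [wtableOk, Bool.and_eq_true] at h
    obtain ⟨hc, hT⟩ := h
    have hcw : Clause N (unitVec N (bword N c.w)) := clause_of_wrowOk dv hdv prev hprev c hc
    rcases List.mem_cons.1 hc' with rfl | hmem
    · exact hcw
    · refine ih (c.w :: prev) ?_ hT c' hmem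
      intro w hw
      rcases List.mem_cons.1 hw with rfl | hw'
      exacts [hcw, hprev w hw']

/-- Splitting a word-table check at an append. [folklore] -/
theorem wtableOk_append (N : ℕ) (dv : List FVec) :
    ∀ (T₁ T₂ : List WRow) (prev : List (List ℕ)),
      wtableOk N dv prev T₁ = true → wtableOk N dv ((T₁.map WRow.w).reverse ++ prev) T₂ = true →
        wtableOk N dv prev (T₁ ++ T₂) = true := by
  intro T₁
  induction T₁ with
  | nil => intro T₂ prev _ h; simpa using h
  | cons c T₁ ih =>
    intro T₂ prev h₁ h₂
    simp only [wtableOk, List.cons_append, Bool.and_eq_true] at h₁ ⊢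
    refine ⟨h₁.1, ih T₂ (c.w :: prev) h₁.2 ?_⟩
    simpa [List.map_cons, List.reverse_cons, List.append_assoc] using h₂

/-- **Coverage through word lists** for word tables. [folklore] -/
theorem wcover_of_lists (N : ℕ) (T : List WRow)
    (h : ∀ ε : Fin N → Bool, Adm ε → List.ofFn ε ∈ T.map fun c => MZV.binaryWord c.w) :
    ∀ ε : Fin N → Bool, Adm ε → ∃ c ∈ T, bword N c.w = ε := by
  intro ε hε
  obtain ⟨c, hc, hcw⟩ := List.mem_map.1 (h ε hε)
  refine ⟨c, hc, ?_⟩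
  change wordOf N (MZV.binaryWord c.w) = ε
  rw [hcw, wordOf_ofFn]

/-- **From a checked derived table and a checked word table to `EdsCertificate N`.** [folklore] -/
theorem edsCertificate_of_dwtables (N : ℕ) (Δ : List DRow) (T : List WRow)
    (hΔ : dtableOk N [] Δ = true) (hT : wtableOk N (Δ.map DRow.vfvec) [] T = true)
    (hcover : ∀ ε : Fin N → Bool, Adm ε → ∃ c ∈ T, bword N c.w = ε) : EdsCertificate N := by
  have hdv : ∀ v ∈ Δ.map DRow.vfvec, Clause N (FVec.eval N v) := fun v hv =>
    clause_of_dtableOk Δ [] (fun v hv => by simp at hv) hΔ v (by simpa using hv)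
  intro ε hε
  obtain ⟨c, hc, rfl⟩ := hcover ε hε
  exact clause_of_wtableOk _ hdv T [] (fun w hw => by simp at hw) hT c hc

end WSoundness

/-! ## The registered stub -/

/-- Soundness of the two-table format (derived rows + word rows), as a statement about this file's own
checkers `dtableOk` / `wtableOk` (not a published fact). -/
def DerivedCertSound : Prop :=
  ∀ (N : ℕ) (Δ : List DRow) (T : List WRow), dtableOk N [] Δ = true →
    wtableOk N (Δ.map DRow.vfvec) [] T = true →
      (∀ ε : Fin N → Bool, Adm ε → ∃ c ∈ T, bword N c.w = ε) → EdsCertificate N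

/-- **Registered stub `stub_derivedCert`** of the skeleton of line `Sketch` (infrastructure for the
weight-`11`/`12` tables). -/
theorem stub_derivedCert : DerivedCertSound := edsCertificate_of_dwtables

/-! ## Smoke test -/

/-- Smoke test (kernel), weight `4`: derived rows `U₀ = fds((2),(2)) = 4e₃₁ − e₄`,
`U₁ = hof((3)) + ¼U₀ = ¾e₄ − e₂₂`, `U₂ = dual(2,1,1) = e₂₁₁ − e₄`; word rows `ζ(2,2)` (Hoffman),
`ζ(4) = (4/3)(U₁ + e₂₂)`, `ζ(3,1) = ¼U₀ + ¼e₄`, `ζ(2,1,1) = U₂ + e₄`. -/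
example : dtableOk 4 []
    [⟨.F [2] [2], [], [([3, 1], 4, 1), ([4], -1, 1)]⟩,
     ⟨.D [3], [(0, 1, 4)], [([4], 3, 4), ([2, 2], -1, 1)]⟩,
     ⟨.K [2, 1, 1], [], [([2, 1, 1], 1, 1), ([4], -1, 1)]⟩] = true := by
  decide +kernel

example : wtableOk 4
    ([⟨.F [2] [2], [], [([3, 1], 4, 1), ([4], -1, 1)]⟩,
      ⟨.D [3], [(0, 1, 4)], [([4], 3, 4), ([2, 2], -1, 1)]⟩,
      ⟨.K [2, 1, 1], [], [([2, 1, 1], 1, 1), ([4], -1, 1)]⟩].map DRow.vfvec) []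
    [⟨[2, 2], [], [([2, 2], 1, 1)], []⟩,
     ⟨[4], [], [([2, 2], 4, 3)], [(1, 4, 3)]⟩,
     ⟨[3, 1], [([4], 1, 4)], [], [(0, 1, 4)]⟩,
     ⟨[2, 1, 1], [([4], 1, 1)], [], [(2, 1, 1)]⟩] = true := by
  decide +kernel

end Summit.KontsevichZagierPeriods.LinRedNormalForm.HoffmanSpanInKZ
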